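import Mathlib.RingTheory.AlgebraicIndependent.TranscendenceBasis
import Mathlib.RingTheory.Algebraic.Integral
import Mathlib.FieldTheory.IntermediateField.Adjoin.Algebra
import Literature.RingTheory.KrullDimension.TranscendenceDegreeOfPoint
import Literature.RingTheory.KrullDimension.AffineCatenary
import Literature.RingTheory.NoetherNormalization.GenericLinearForms
import Literature.NumberTheory.Transcendental.NesterenkoChowFormPrime

/-!
# `codim Sing(per₄) = 8` — tools: algebraic-dependence bookkeeping at a point and the
# transcendence-degree / height bridge

Helper file (no definitions, no `sorry`) for the exact value `codim Sing(per₄) = 8`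
(`…PolyaContinuedLaplaceRigiditySingCodimEight`), the R3-row number of line `laplace_rigidity` on
crux `CoverDecancellation` (stmt-ValiantsHypothesis-17819).  The proof of `8 ≤ height` is a
generic-point argument: for a point `z` of the variety over a field `L ⊇ F` one bounds the
transcendence degree `trdeg_F F[z] ≤ 8` by exhibiting, case by case, at most eight coordinates over
which all others are algebraic, and converts this into `height (ker (f ↦ f(z))) ≥ 16 - 8` by the
catenary dimension formula for affine domains (tree: `Literature.RingTheory.KrullDimension.
ringKrullDim_quotient_add_height`) and `dim F[X]/I({z}) = trdeg_F F(z)` (tree: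
`Literature.RingTheory.KrullDimension.ringKrullDim_quotient_vanishingIdeal_singleton`).

This file collects the bookkeeping, all [folklore]:
* `alg_of_mem`, `alg_of_eq_zero`, `alg_of_mul_eq` (a coordinate solved from `c·x = d`, `c ≠ 0`,
  is algebraic over the subalgebra containing `c, d`), `alg_trans` (transitivity = idempotence of
  the algebraic-matroid closure, Mathlib `IsAlgebraic.adjoin_of_forall_isAlgebraic`);
* `trdeg_adjoin_le_card_of_forall_alg`, `trdeg_adjoin_le_trdeg_of_forall_alg`,
  `trdeg_adjoin_union_singleton_le`, `trdeg_adjoin_union_pair_le` (counting);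
* `trdeg_adjoin_range_le_of_aeval_eq_zero` — a non-trivial polynomial relation among `n + 1`
  elements drops the transcendence degree to `≤ n`;
* `natCast_sub_le_height_ker_aeval` — **the bridge**: `card ι - d ≤ height (ker (aeval z))`
  whenever `trdeg_F F[z] ≤ d`, for a point `z : ι → L` with values in a field extension.

Honest framing: dictionary/tool work; VP ≠ VNP is NOT proved and no summit statement is touched.
-/

set_option linter.dupNamespace false

noncomputable section

namespace Summit.ValiantsHypothesis.ValiantsHypothesis.Theorems.PolyaContinuedLaplaceRigidity.SingCodim

open MvPolynomial Cardinal

variable {F : Type*} [Field F] {L : Type*} [Field L] [Algebra F L]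

/-! ### Algebraicity over generated subalgebras -/

/-- An element of `S` is algebraic over `F[S]`. [folklore] -/
theorem alg_of_mem {S : Set L} {x : L} (hx : x ∈ S) : IsAlgebraic (Algebra.adjoin F S) x :=
  isAlgebraic_algebraMap (⟨x, Algebra.subset_adjoin hx⟩ : Algebra.adjoin F S)

/-- A vanishing coordinate is algebraic over anything. [folklore] -/
theorem alg_of_eq_zero (S : Set L) {x : L} (hx : x = 0) : IsAlgebraic (Algebra.adjoin F S) x := by
  rw [hx]; exact isAlgebraic_zero

/-- **Solving a coordinate**: if `c * x = d` with `c ≠ 0` and `c, d ∈ F[S]`, then `x` is algebraic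
over `F[S]` (it is a root of the non-zero linear polynomial `c T - d`). [folklore] -/
theorem alg_of_mul_eq {S : Set L} {x c d : L} (hc : c ∈ Algebra.adjoin F S)
    (hd : d ∈ Algebra.adjoin F S) (hc0 : c ≠ 0) (h : c * x = d) :
    IsAlgebraic (Algebra.adjoin F S) x := by
  refine ⟨Polynomial.C (⟨c, hc⟩ : Algebra.adjoin F S) * Polynomial.X -
    Polynomial.C (⟨d, hd⟩ : Algebra.adjoin F S), ?_, ?_⟩
  · intro h0
    have h1 := congrArg (fun q => Polynomial.coeff q 1) h0
    simp only [Polynomial.coeff_sub, Polynomial.coeff_C_mul, Polynomial.coeff_X_one, mul_one,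
      Polynomial.coeff_C, one_ne_zero, if_false, sub_zero, Polynomial.coeff_zero] at h1
    exact hc0 (congrArg Subtype.val h1)
  · simp only [map_sub, map_mul, Polynomial.aeval_C, Polynomial.aeval_X]
    change c * x - d = 0
    rw [h, sub_self]

/-- **Transitivity**: algebraic over `F[S]`, and every element of `S` algebraic over `F[T]`,
gives algebraic over `F[T]`. [folklore] -/
theorem alg_trans {S T : Set L} {x : L} (hx : IsAlgebraic (Algebra.adjoin F S) x)
    (hST : ∀ y ∈ S, IsAlgebraic (Algebra.adjoin F T) y) :
    IsAlgebraic (Algebra.adjoin F T) x :=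
  hx.adjoin_of_forall_isAlgebraic fun y hy => hST y hy.1

/-- Monotonicity in the generating set. [folklore] -/
theorem alg_mono {S T : Set L} (hST : S ⊆ T) {x : L} (hx : IsAlgebraic (Algebra.adjoin F S) x) :
    IsAlgebraic (Algebra.adjoin F T) x :=
  alg_trans hx fun _ hy => alg_of_mem (hST hy)


/-- Generators lie in the generated subalgebra. [folklore] -/
theorem mem_adjoin_of_mem {S : Set L} {x : L} (hx : x ∈ S) : x ∈ Algebra.adjoin F S :=
  Algebra.subset_adjoin hx

/-! ### Counting -/

/-- If every element of `U` is algebraic over `F[T]` then `trdeg_F F[U] ≤ #T`. [folklore] -/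
theorem trdeg_adjoin_le_card_of_forall_alg {U T : Set L}
    (h : ∀ x ∈ U, IsAlgebraic (Algebra.adjoin F T) x) :
    Algebra.trdeg F (Algebra.adjoin F U) ≤ #T :=
  Literature.RingTheory.NoetherNormalization.trdeg_adjoin_le_of_forall_isAlgebraic h

/-- If every element of `U` is algebraic over `F[T]` then `trdeg_F F[U] ≤ trdeg_F F[T]`. [folklore] -/
theorem trdeg_adjoin_le_trdeg_of_forall_alg {U T : Set L}
    (h : ∀ x ∈ U, IsAlgebraic (Algebra.adjoin F T) x) :
    Algebra.trdeg F (Algebra.adjoin F U) ≤ Algebra.trdeg F (Algebra.adjoin F T) :=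
  Literature.RingTheory.NoetherNormalization.trdeg_adjoin_le_trdeg_adjoin_of_forall_isAlgebraic h

/-- If every element of `U` is algebraic over `F[T]` for a finset `T` with `#T ≤ n`, then
`trdeg_F F[U] ≤ n`. [folklore] -/
theorem trdeg_adjoin_le_nat_of_forall_alg {U : Set L} {T : Finset L} {n : ℕ} (hT : T.card ≤ n)
    (h : ∀ x ∈ U, IsAlgebraic (Algebra.adjoin F (T : Set L)) x) :
    Algebra.trdeg F (Algebra.adjoin F U) ≤ n := by
  refine (trdeg_adjoin_le_card_of_forall_alg h).trans ?_
  rw [Finset.coe_sort_coe, mk_coe_finset]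
  exact_mod_cast hT

/-- Adjoining one more element raises the transcendence degree by at most one. [folklore] -/
theorem trdeg_adjoin_union_singleton_le (S : Set L) (a : L) :
    Algebra.trdeg F (Algebra.adjoin F (S ∪ {a})) ≤ Algebra.trdeg F (Algebra.adjoin F S) + 1 := by
  have h := Literature.RingTheory.NoetherNormalization.trdeg_adjoin_union_le (K := F) S ({a} : Set L)
  rwa [mk_singleton] at h

/-- Adjoining two more elements raises the transcendence degree by at most two. [folklore] -/
theorem trdeg_adjoin_union_pair_le (S : Set L) (a b : L) :
    Algebra.trdeg F (Algebra.adjoin F (S ∪ {a, b})) ≤ Algebra.trdeg F (Algebra.adjoin F S) + 2 := by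
  have h := Literature.RingTheory.NoetherNormalization.trdeg_adjoin_union_le (K := F) S ({a, b} : Set L)
  refine h.trans (add_le_add le_rfl ?_)
  refine (mk_insert_le).trans ?_
  rw [mk_singleton]
  norm_num

/-- The transcendence degree of `F[range w]` for `w : Fin n → L` is at most `n`. [folklore] -/
theorem trdeg_adjoin_range_le {n : ℕ} (w : Fin n → L) :
    Algebra.trdeg F (Algebra.adjoin F (Set.range w)) ≤ n := by
  refine (trdeg_adjoin_le_card_of_forall_alg (T := Set.range w) fun x hx => alg_of_mem hx).trans ?_
  simpa using (mk_range_le_lift (f := w))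


/-- **Cover bound**: if every element of `U` is algebraic over `F[range f]` for some
`f : Fin k → L`, then `trdeg_F F[U] ≤ k`. [folklore] -/
theorem trdeg_adjoin_le_of_cover {U : Set L} {k : ℕ} (f : Fin k → L)
    (h : ∀ x ∈ U, IsAlgebraic (Algebra.adjoin F (Set.range f)) x) :
    Algebra.trdeg F (Algebra.adjoin F U) ≤ k :=
  (trdeg_adjoin_le_trdeg_of_forall_alg h).trans (trdeg_adjoin_range_le f)

/-- **Cover bound, two pieces**: if every element of `U` is algebraic over
`F[range f ∪ range g]` (`f : Fin j → L`, `g : Fin k → L`), then `trdeg_F F[U] ≤ j + k`. [folklore] -/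
theorem trdeg_adjoin_le_of_cover_two {U : Set L} {j k : ℕ} (f : Fin j → L) (g : Fin k → L)
    (h : ∀ x ∈ U, IsAlgebraic (Algebra.adjoin F (Set.range f ∪ Set.range g)) x) :
    Algebra.trdeg F (Algebra.adjoin F U) ≤ j + k := by
  refine (trdeg_adjoin_le_card_of_forall_alg h).trans ((mk_union_le _ _).trans ?_)
  have hf : #(Set.range f) ≤ j := by simpa using (mk_range_le_lift (f := f))
  have hg : #(Set.range g) ≤ k := by simpa using (mk_range_le_lift (f := g))
  exact_mod_cast add_le_add hf hg

/-- **Cover bound plus extra elements**: if every element of `U` is algebraic over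
`F[T ∪ range g]` with `trdeg_F F[T] ≤ m` and `g : Fin k → L`, then `trdeg_F F[U] ≤ m + k`. [folklore] -/
theorem trdeg_adjoin_le_of_cover_add {U T : Set L} {m k : ℕ} (hT : Algebra.trdeg F (Algebra.adjoin F T) ≤ m)
    (g : Fin k → L) (h : ∀ x ∈ U, IsAlgebraic (Algebra.adjoin F (T ∪ Set.range g)) x) :
    Algebra.trdeg F (Algebra.adjoin F U) ≤ m + k := by
  refine (trdeg_adjoin_le_trdeg_of_forall_alg h).trans ?_
  refine (Literature.RingTheory.NoetherNormalization.trdeg_adjoin_union_le (K := F) T _).trans ?_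
  have hg : #(Set.range g) ≤ k := by simpa using (mk_range_le_lift (f := g))
  exact_mod_cast add_le_add hT hg

/-! ### A relation drops the transcendence degree -/

/-- **A non-trivial polynomial relation among `n + 1` elements drops the transcendence degree of
the subalgebra they generate to at most `n`.**  (Otherwise the `n + 1` generators would be a
transcendence basis of `F[w]`, Mathlib
`Algebra.IsAlgebraic.isTranscendenceBasis_of_le_trdeg_of_finite`, hence algebraically
independent.) [folklore] -/
theorem trdeg_adjoin_range_le_of_aeval_eq_zero {n : ℕ} (w : Fin (n + 1) → L)
    {P : MvPolynomial (Fin (n + 1)) F} (hP : P ≠ 0) (hw : aeval w P = 0) :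
    Algebra.trdeg F (Algebra.adjoin F (Set.range w)) ≤ n := by
  classical
  set A : Subalgebra F L := Algebra.adjoin F (Set.range w) with hA
  by_contra hlt
  have hle : ((n + 1 : ℕ) : Cardinal) ≤ Algebra.trdeg F A := by
    have h1 : (n : Cardinal) < Algebra.trdeg F A := not_le.mp hlt
    have h3 := Order.succ_le_of_lt h1
    rw [Cardinal.succ_natCast] at h3
    exact_mod_cast h3
  -- the generators, as elements of `A`
  let x : Fin (n + 1) → A := fun i => ⟨w i, Algebra.subset_adjoin ⟨i, rfl⟩⟩
  have hxval : ∀ i, ((x i : A) : L) = w i := fun i => rfl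
  -- `A` is generated by `range x`, hence algebraic over `F[range x]`
  have htop : Algebra.adjoin F (Set.range x) = ⊤ := by
    apply Subalgebra.map_injective (f := A.val) Subtype.val_injective
    rw [Algebra.map_top, Subalgebra.range_val, AlgHom.map_adjoin, ← Set.range_comp]
    rfl
  haveI : Algebra.IsAlgebraic (Algebra.adjoin F (Set.range x)) A := by
    rw [htop]
    exact ⟨fun a => isAlgebraic_algebraMap (⟨a, Algebra.mem_top⟩ : (⊤ : Subalgebra F A))⟩
  haveI : FaithfulSMul F A :=
    (faithfulSMul_iff_algebraMap_injective F A).mpr (algebraMap F A).injective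
  have hB := Algebra.IsAlgebraic.isTranscendenceBasis_of_lift_le_trdeg_of_finite F x
    (by simpa using hle)
  have hind : AlgebraicIndependent F w := by
    have h := hB.1.map' (f := A.val) (fun a b hab => Subtype.ext hab)
    have hcomp : (A.val : A → L) ∘ x = w := funext hxval
    rwa [← hcomp]
  rw [algebraicIndependent_iff] at hind
  exact hP (hind P hw)

/-! ### The bridge: transcendence degree of a point versus the height of its kernel -/

/-- **Bridge.** For a point `z : ι → L` with values in a field extension `L ⊇ F` and `ι` finite:
if `trdeg_F F[z] ≤ d` then `card ι - d ≤ height (ker (f ↦ f(z)))`.  Proof: `ker = I_F({z})` is a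
prime of the affine domain `F[X_ι]`, `dim F[X_ι]/I({z}) + height = card ι` (catenary dimension
formula) and `dim F[X_ι]/I({z}) = trdeg_F F(z) = trdeg_F F[z]`. [folklore] -/
theorem natCast_sub_le_height_ker_aeval {ι : Type} [Fintype ι] (z : ι → L) {d : ℕ}
    (hd : Algebra.trdeg F (Algebra.adjoin F (Set.range z)) ≤ d) :
    ((Fintype.card ι - d : ℕ) : ℕ∞) ≤ (RingHom.ker (aeval (R := F) z)).height := by
  classical
  set P : Ideal (MvPolynomial ι F) := RingHom.ker (aeval (R := F) z) with hPdef
  haveI hP : P.IsPrime := RingHom.ker_isPrime _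
  haveI : IsDomain (MvPolynomial ι F ⧸ P) := Ideal.Quotient.isDomain P
  haveI : Algebra.FiniteType F (MvPolynomial ι F ⧸ P) :=
    (inferInstance : Algebra.FiniteType F (MvPolynomial ι F)).of_surjective
      (Ideal.Quotient.mkₐ F P) Ideal.Quotient.mk_surjective
  -- catenary: `dim (F[X]/P) + height P = card ι`
  have hcat := Literature.RingTheory.KrullDimension.ringKrullDim_quotient_add_height (F := F) P
  rw [MvPolynomial.ringKrullDim_of_isNoetherianRing, ringKrullDim_eq_zero_of_field F, zero_add,
    Nat.card_eq_fintype_card] at hcat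
  -- `dim F[X]/P = trdeg F(z)`
  have hvan : vanishingIdeal F ({z} : Set (ι → L)) = P := by
    rw [hPdef, Literature.RingTheory.KrullDimension.vanishingIdeal_singleton_eq_ker]
  have hdim := Literature.RingTheory.KrullDimension.ringKrullDim_quotient_vanishingIdeal_singleton
    (k := F) z
  rw [hvan] at hdim
  -- `trdeg F(z) = trdeg F[z] ≤ d`
  have htr : Cardinal.toNat (Algebra.trdeg F (IntermediateField.adjoin F (Set.range z))) ≤ d := by
    rw [Literature.RingTheory.KrullDimension.trdeg_intermediateFieldAdjoin_eq]
    have hfin : Algebra.trdeg F (Algebra.adjoin F (Set.range z)) < ℵ₀ :=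
      lt_of_le_of_lt hd (Cardinal.natCast_lt_aleph0 (n := d))
    have := hd
    rw [← Cardinal.cast_toNat_of_lt_aleph0 hfin] at this
    exact_mod_cast this
  -- assemble in `WithBot ℕ∞`
  rw [hdim] at hcat
  cases hh : P.height with
  | top => exact le_top
  | coe m =>
      rw [hh] at hcat
      have h1 : ((Cardinal.toNat (Algebra.trdeg F (IntermediateField.adjoin F (Set.range z))) +
          m : ℕ) : WithBot ℕ∞) = ((Fintype.card ι : ℕ) : WithBot ℕ∞) := by
        push_cast
        exact_mod_cast hcat
      have h2 : Cardinal.toNat (Algebra.trdeg F (IntermediateField.adjoin F (Set.range z))) + m =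
          Fintype.card ι := by exact_mod_cast h1
      exact_mod_cast (by omega : Fintype.card ι - d ≤ m)

end Summit.ValiantsHypothesis.ValiantsHypothesis.Theorems.PolyaContinuedLaplaceRigidity.SingCodim

end
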